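import Summits.AtomisticToContinuum.Crystallization.Theorems.ChargedEnergyGap.Negative.NoBoundaryReduction
import Summits.AtomisticToContinuum.Crystallization.Theorems.PricedLinkCensusChargedEnergyGapRegularise
import Summits.AtomisticToContinuum.Crystallization.Theorems.PricedLinkCensusChargedEnergyGapChargeRecount
import HarnessLib

/-!
# Line `defect-zoom-compactness` (crux `PricedLinkCensus.ChargedEnergyGap`, stmt-AtomisticToContinuum-14231): the hard-core reduction

Stub `stub_hardCoreReduction` of the line skeleton.  Write `E(y) = ∑_{i<j} V_LJ(|yᵢ − yⱼ|)` for the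
Lennard-Jones energy of `y : Fin N → ℝ³`, `#ch(y)` for its number of CHARGED sites (not charge-free at
tolerance `1/100`, `ChargedEnergyGapNegative.charged`) and `e* = ⨅_Q e_LJ(Q)`
(`ChargedEnergyGapNegative.eStar`).  CLAIM: if some `κ > 0` prices charge on HARD-CORE configurations,
`N·e* + κ·#ch(y) ≤ E(y)` for every injective `1/4`-separated `y`, then some `κ' > 0` prices it on ALL
injective configurations, `NoBoundary (1/100) κ'`.

Proof.  A `1/3`-separated configuration is `1/4`-separated and injective (two distinct indices sit at
distance `≥ 1/3 > 0`), so the hypothesis is the separated priced gap relative to `e = e*` with allowance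
`C = 0`.  The landed regularisation `BarlowRelativePricingRegularise.stub_regularise` (closest-pair
deletion; its recount hypothesis is the landed `BarlowRelativePricingRecount.stub_chargeRecount`) lifts
it to all injective configurations with an allowance `C·N^(2/3)`, which is `ChargedEnergyGap` verbatim
(`chargedEnergyGap_iff`), and `chargedEnergyGap_iff_noBoundary` removes the allowance.  All `[folklore]`.
-/

noncomputable section

namespace Summit.AtomisticToContinuum.Crystallization.Theorems.DefectZoomCompactnessHardCore

open Literature.MathematicalPhysics.StatisticalMechanics
open Literature.Geometry.DiscreteGeometry
open Summit.AtomisticToContinuum.Crystallization.Theses.PricedLinkCensus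
open Summit.AtomisticToContinuum.Crystallization.Theorems.ChargedEnergyGapNegative

/-- A `1/3`-separated configuration satisfies the separated priced charge gap handed to
`stub_regularise` (relative to `e*`, allowance `C = 0`) as soon as charge is priced at rate `κ` on
injective `1/4`-separated configurations: `1/4 ≤ 1/3 ≤ dist`, and distinct indices are at positive
distance, hence injectivity. [folklore] -/
theorem separatedGap_of_hardCore {κ : ℝ}
    (h : ∀ (N : ℕ) (y : Fin N → EuclideanSpace ℝ (Fin 3)), Function.Injective y →
      (∀ i j : Fin N, i ≠ j → (1 / 4 : ℝ) ≤ dist (y i) (y j)) →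
      (N : ℝ) * eStar + κ * (charged (1 / 100) y : ℝ) ≤ interactionEnergy lennardJones y)
    (N : ℕ) (y : Fin N → EuclideanSpace ℝ (Fin 3))
    (hy : ∀ i j : Fin N, i ≠ j → (1 / 3 : ℝ) ≤ dist (y i) (y j)) :
    (N : ℝ) * eStar + κ * (Nat.card {i : Fin N // ¬ IsChargeFree (1 / 100 : ℝ) y i} : ℝ)
      - 0 * (N : ℝ) ^ (2 / 3 : ℝ) ≤ interactionEnergy lennardJones y := by
  have hinj : Function.Injective y := by
    intro i j hij
    by_contra hne
    have h3 := hy i j hne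
    rw [hij, dist_self] at h3
    norm_num at h3
  have h4 : ∀ i j : Fin N, i ≠ j → (1 / 4 : ℝ) ≤ dist (y i) (y j) := fun i j hij =>
    le_trans (by norm_num) (hy i j hij)
  have hE := h N y hinj h4
  rw [zero_mul, sub_zero]
  exact hE

/-- **Stub `stub_hardCoreReduction` — it suffices to price charge on hard-core configurations.**
If some `κ > 0` gives `N·e* + κ·#ch(y) ≤ E_LJ(y)` for every injective `1/4`-separated
`y : Fin N → ℝ³`, then `∃ κ' > 0, NoBoundary (1/100) κ'`: every finite injective configuration
pays `κ'` per charged site above `N·e*`.  The separated gap (`separatedGap_of_hardCore`, `C = 0`)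
is lifted to all injective configurations by `BarlowRelativePricingRegularise.stub_regularise` fed
with `BarlowRelativePricingRecount.stub_chargeRecount`; the result is `ChargedEnergyGap`
(`chargedEnergyGap_iff`), and `chargedEnergyGap_iff_noBoundary` drops the allowance. [folklore] -/
theorem stub_hardCoreReduction : (∃ κ : ℝ, 0 < κ ∧ ∀ (N : ℕ) (y : Fin N → EuclideanSpace ℝ (Fin 3)), Function.Injective y → (∀ i j : Fin N, i ≠ j → (1 / 4 : ℝ) ≤ dist (y i) (y j)) → (N : ℝ) * Summit.AtomisticToContinuum.Crystallization.Theorems.ChargedEnergyGapNegative.eStar + κ * (Summit.AtomisticToContinuum.Crystallization.Theorems.ChargedEnergyGapNegative.charged (1 / 100) y : ℝ) ≤ Literature.MathematicalPhysics.StatisticalMechanics.interactionEnergy Literature.MathematicalPhysics.StatisticalMechanics.lennardJones y) → ∃ κ : ℝ, 0 < κ ∧ Summit.AtomisticToContinuum.Crystallization.Theorems.ChargedEnergyGapNegative.NoBoundary (1 / 100) κ := by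
  rintro ⟨κ, hκ, h⟩
  obtain ⟨κ', hκ', C, hC⟩ := BarlowRelativePricingRegularise.stub_regularise
    BarlowRelativePricingRecount.stub_chargeRecount eStar
    ⟨κ, hκ, 0, separatedGap_of_hardCore h⟩
  exact chargedEnergyGap_iff_noBoundary.1 (chargedEnergyGap_iff.2 ⟨κ', C, hκ', hC⟩)

/-- **Hard core without loss of generality.**  The crux `ChargedEnergyGap` is EQUIVALENT to the
hard-core priced gap: some `κ > 0` gives `N·e* + κ·#ch(y) ≤ E_LJ(y)` for every injective
`1/4`-separated `y : Fin N → ℝ³` (no boundary allowance).  Forward: `chargedEnergyGap_iff_noBoundary`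
prices every injective configuration, in particular the separated ones; backward:
`stub_hardCoreReduction`.  With `chargedEnergyGap_iff_noBoundary` (Negative II) and
`chargedEnergyGap_iff_periodicPricing` (Negative VII) this is the third reduced form of the crux; it is
the entry point of line `defect-zoom-compactness` (compactness needs a uniform minimal distance).
[folklore] -/
theorem chargedEnergyGap_iff_hardCore :
    ChargedEnergyGap ↔ ∃ κ : ℝ, 0 < κ ∧ ∀ (N : ℕ) (y : Fin N → EuclideanSpace ℝ (Fin 3)),
      Function.Injective y → (∀ i j : Fin N, i ≠ j → (1 / 4 : ℝ) ≤ dist (y i) (y j)) →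
        (N : ℝ) * eStar + κ * (charged (1 / 100) y : ℝ) ≤ interactionEnergy lennardJones y := by
  constructor
  · intro h
    obtain ⟨κ, hκ, hNB⟩ := chargedEnergyGap_iff_noBoundary.1 h
    exact ⟨κ, hκ, fun N y hy _ => hNB N y hy⟩
  · intro h
    exact chargedEnergyGap_iff_noBoundary.2 (stub_hardCoreReduction h)

end Summit.AtomisticToContinuum.Crystallization.Theorems.DefectZoomCompactnessHardCore

end
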